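import Literature.NumberTheory.EllipticCurves.ThreeTorsionRadicalsPointsProofs
import Literature.NumberTheory.EllipticCurves.DivisionField
import HarnessLib

/-!
# The three cube roots of `Δ` lie in the `3`-division field `ℚ(E[3])`
# (cell `b2b-bsdres`, team n1011, seat p02 gen 4 — row T-b11 ARM A 'm = 3 structure', file F3a;
# pure algebra over the tree's `3`-torsion radicals)

HONEST FRAMING (cell `b2b-bsdres`, run/shared/lean/b2b/bsd-rank1-residual/, verbatim in every
file): the goal of the cell is to DELETE the COMBINATION-SHAPED residual classes of the
Birch–Swinnerton-Dyer formula for ALL analytic-rank `≤ 1` elliptic curves over `ℚ` — "full BSD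
formula for every rank `≤ 1` curve in class `C`" assembled STRICTLY from published theorems — so
that the rank-`≤ 1` remainder becomes exactly the CONSTRUCTION-SHAPED classes, which are TYPED
(missing-input `Prop`s), NOT attempted. This is not "finishing BSD". Team n1011 (N10 / N11):
research route; no claim beyond the stated classes; labels UNCHANGED; nothing is booked. Theorems
only (no definition, no named fact).

## What this file proves

For an elliptic curve `E = W/K` over any field of characteristic `0` (`K = ℚ` in the cell):

* `exists_cubeRoots_Δ_mem_divisionField_three` — there are `ω, δ ∈ K̄` with `ω² + ω + 1 = 0`,
  `δ³ = Δ`, and **`δ, ωδ, ω²δ ∈ K(E[3])`** (the `3`-division field, tree `divisionField`).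

Proof (Euler's solution of the quartic `Ψ₃`, tree `ThreeTorsionRadicalsProofs`): with the radicals
`U_k² = c₄ − 12ωᵏδ`, `U₀U₁U₂ = c₆` of `exists_radicals`, the four numbers
`x_s = (−b₂ ± U₀ ± U₁ ± U₂)/12` (even number of minus signs) are abscissae of points of order `3`
(`three_smul_eq_zero_of_twelve_mul_add_eq`), hence lie in `K(E[3])` (`mem_divisionField_of_eq_some`),
and `(12x₁)(12x₂) + (12x₃)(12x₄) = 48(b₄ − ωᵏδ)` for the three pairings (`pair_mul_add_pair_mul_eq`,
`…_one`, `…_two`): `ωᵏδ = b₄ − 3(x₁x₂ + x₃x₄) ∈ K(E[3])`.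

Use (row T-b11 F3, this seat): at `v₃(j − 1728) = 3` with `f₃ = 3`, `v₃(j) ≥ 6`, `c₆′ ≡ ±2 (9)` a
rational multiple of `ωᵏδ` is `3`-adically closer to a `2`-torsion abscissa than the `9`-torsion
abscissae are (ARM A's transport), which puts an element of valuation-denominator `27` inside
`ℚ(E[9])` and forces `27 ∣ #ρ̄₉(I₃)`.  Nothing booked; no label change.

References: [Serre1972] J.-P. Serre, Propriétés galoisiennes…, Invent. Math. 15 (1972) §5.3
(`ℚ(E[3]) ⊇ ℚ(μ₃, ∛Δ)`); [SilvermanAEC2009] III.1, Ex. 3.7.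
-/

noncomputable section

open scoped Classical

open WeierstrassCurve Literature.NumberTheory.EllipticCurves.ThreeTorsionRadicals

namespace Summit.BirchSwinnertonDyer.Rank1Residual.GaloisImage

universe u

variable {K : Type u} [Field K] [CharZero K] (W : WeierstrassCurve K) [W.IsElliptic]

omit [CharZero K] [W.IsElliptic] in
/-- A point of order dividing `3` of `E ⊗ K̄` given by coordinates has its abscissa in `K(E[3])`.
[folklore] -/
private theorem x_mem_divisionField_three_of_smul_eq_zero
    {x y : AlgebraicClosure K}
    (h : (W.map (algebraMap K (AlgebraicClosure K))).toAffine.Nonsingular x y)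
    (h3 : (3 : ℤ) • (Affine.Point.some x y h :
      (W.map (algebraMap K (AlgebraicClosure K))).toAffine.Point) = 0) :
    x ∈ W.divisionField 3 := by
  have hmem : (Affine.Point.some x y h : geomPoints W) ∈ geomTorsion W ((3 : ℕ) : ℤ) :=
    (Submodule.mem_torsionBy_iff _ _).mpr (by exact_mod_cast h3)
  exact (W.mem_divisionField_of_eq_some (n := 3) (T := ⟨_, hmem⟩) rfl).1

/-- **The cube roots of `Δ` lie in the `3`-division field.**  For an elliptic curve `E = W/K`
(`char K = 0`) there are `ω, δ ∈ K̄` with `ω² + ω + 1 = 0`, `δ³ = Δ` and `δ, ωδ, ω²δ ∈ K(E[3])`;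
explicitly `ωᵏδ = b₄ − 3(x₁x₂ + x₃x₄)` for a pairing of the four `3`-torsion abscissae (Euler's
resolvent cubic of `Ψ₃`). [cite: Serre1972, §5.3] [cite: SilvermanAEC2009, III.1 and Exercise 3.7] -/
theorem exists_cubeRoots_Δ_mem_divisionField_three :
    ∃ ω δ : AlgebraicClosure K, ω ^ 2 + ω + 1 = 0 ∧
      δ ^ 3 = algebraMap K (AlgebraicClosure K) W.Δ ∧
      δ ∈ W.divisionField 3 ∧ ω * δ ∈ W.divisionField 3 ∧ ω ^ 2 * δ ∈ W.divisionField 3 := by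
  set V := W.map (algebraMap K (AlgebraicClosure K)) with hV
  obtain ⟨ω, δ, U₀, U₁, U₂, hω, hδ, h₀, h₁, h₂, hp⟩ :=
    exists_radicals (F := AlgebraicClosure K) V.c₄ V.c₆ V.Δ V.c_relation
  -- the four `3`-torsion abscissae `(−b₂ + s)/12`, `s` the four admissible sign patterns
  have h12 : (12 : AlgebraicClosure K) ≠ 0 := by norm_num
  -- a point of order `3` above each sign pattern, from the radicals with two signs flipped
  have key : ∀ (V₀ V₁ V₂ : AlgebraicClosure K), V₀ ^ 2 = V.c₄ - 12 * δ →
      V₁ ^ 2 = V.c₄ - 12 * ω * δ → V₂ ^ 2 = V.c₄ - 12 * ω ^ 2 * δ → V₀ * V₁ * V₂ = V.c₆ →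
      (-V.b₂ + V₀ + V₁ + V₂) / 12 ∈ W.divisionField 3 := by
    intro V₀ V₁ V₂ g₀ g₁ g₂ gp
    set x : AlgebraicClosure K := (-V.b₂ + V₀ + V₁ + V₂) / 12 with hx
    have hx12 : 12 * x + V.b₂ = V₀ + V₁ + V₂ := by rw [hx]; field_simp; ring
    obtain ⟨y, hy⟩ := V.exists_equation x
    have hns : V.toAffine.Nonsingular x y := (Affine.equation_iff_nonsingular ..).mp hy
    exact x_mem_divisionField_three_of_smul_eq_zero W hns
      (three_smul_eq_zero_of_twelve_mul_add_eq hω g₀ g₁ g₂ gp hns hx12)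
  -- the four abscissae
  have hxA := key U₀ U₁ U₂ h₀ h₁ h₂ hp
  have hxB := key U₀ (-U₁) (-U₂) h₀ (by rw [neg_sq, h₁]) (by rw [neg_sq, h₂])
    (by rw [← hp]; ring)
  have hxC := key (-U₀) U₁ (-U₂) (by rw [neg_sq, h₀]) h₁ (by rw [neg_sq, h₂])
    (by rw [← hp]; ring)
  have hxD := key (-U₀) (-U₁) U₂ (by rw [neg_sq, h₀]) (by rw [neg_sq, h₁]) h₂
    (by rw [← hp]; ring)
  -- `b₂, b₄ ∈ K ⊆ K(E[3])`
  have hc₄ : V.c₄ = V.b₂ ^ 2 - 24 * V.b₄ := by rw [WeierstrassCurve.c₄]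
  have hb₄ : V.b₄ ∈ W.divisionField 3 := by
    rw [hV, map_b₄]; exact IntermediateField.algebraMap_mem _ _
  have hΔ : V.Δ = algebraMap K (AlgebraicClosure K) W.Δ := by rw [hV, map_Δ]
  -- the three resolvent identities: `ωᵏδ = b₄ − 3(x x' + x'' x''')`
  have eA := pair_mul_add_pair_mul_eq (b₂ := V.b₂) (b₄ := V.b₄) hω h₀ h₁ h₂ hc₄
  have eB := pair_mul_add_pair_mul_eq_one (b₂ := V.b₂) (b₄ := V.b₄) hω h₀ h₁ h₂ hc₄
  have eC := pair_mul_add_pair_mul_eq_two (b₂ := V.b₂) (b₄ := V.b₄) hω h₀ h₁ h₂ hc₄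
  refine ⟨ω, δ, hω, by rw [hδ, hΔ], ?_, ?_, ?_⟩
  · -- `δ = b₄ − 3 (x_A x_B + x_C x_D)`
    have e : δ = V.b₄ - 3 * (((-V.b₂ + U₀ + U₁ + U₂) / 12) * ((-V.b₂ + U₀ + -U₁ + -U₂) / 12) +
        ((-V.b₂ + -U₀ + U₁ + -U₂) / 12) * ((-V.b₂ + -U₀ + -U₁ + U₂) / 12)) := by
      linear_combination (1 / 48 : AlgebraicClosure K) * eA
    rw [e]
    exact sub_mem hb₄ (mul_mem (IntermediateField.natCast_mem _ 3)
      (add_mem (mul_mem hxA hxB) (mul_mem hxC hxD)))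
  · have e : ω * δ = V.b₄ - 3 * (((-V.b₂ + U₀ + U₁ + U₂) / 12) * ((-V.b₂ + -U₀ + U₁ + -U₂) / 12) +
        ((-V.b₂ + U₀ + -U₁ + -U₂) / 12) * ((-V.b₂ + -U₀ + -U₁ + U₂) / 12)) := by
      linear_combination (1 / 48 : AlgebraicClosure K) * eB
    rw [e]
    exact sub_mem hb₄ (mul_mem (IntermediateField.natCast_mem _ 3)
      (add_mem (mul_mem hxA hxC) (mul_mem hxB hxD)))
  · have e : ω ^ 2 * δ = V.b₄ - 3 * (((-V.b₂ + U₀ + U₁ + U₂) / 12) * ((-V.b₂ + -U₀ + -U₁ + U₂) / 12) +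
        ((-V.b₂ + U₀ + -U₁ + -U₂) / 12) * ((-V.b₂ + -U₀ + U₁ + -U₂) / 12)) := by
      linear_combination (1 / 48 : AlgebraicClosure K) * eC
    rw [e]
    exact sub_mem hb₄ (mul_mem (IntermediateField.natCast_mem _ 3)
      (add_mem (mul_mem hxA hxD) (mul_mem hxB hxC)))

end Summit.BirchSwinnertonDyer.Rank1Residual.GaloisImage

end
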